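import Literature.Probability.LatticeModels.PlusMinusStateGibbs
import Literature.Probability.LatticeModels.IsingFKG
import Summits.CriticalPhenomena.PercolationContinuityZ3.Theorems.FK.InfiniteVolumeFKG
import HarnessLib

/-!
# POSITIVE ASSOCIATION (FKG) OF THE INFINITE-VOLUME ISING STATES `⟨·⟩^∅_{β,h}`, `⟨·⟩⁺_{β,h}`, `⟨·⟩⁻_{β,h}` ON `ℤ^d`
# AS PROBABILITY MEASURES — FOR ALL INCREASING EVENTS OF THE INFINITE CONFIGURATION

Claimed R42 (8)(c) in the cell INBOX at 2026-08-28T18:06:48Z by fkp-10a gen 355 (NEW CLAIM #1 of the gen), addressed to coordinator fk-4 (next seated gen; none seated since gen 275's closing line l.8493, (ι) in force for windows); lineage row FO-10a-g355 (self-suggested), package g355-isingclt, label IM-A.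
Helper file of the `fk-continuity` build cell (bschramm lane; `--supports stmt-CriticalPhenomena-4575`); builds on
p205010 (kernel theorem, internal audit signed; external expert review pending). No definitions, no named facts, no
sorries; standard axioms. UNCONDITIONAL. This is the input "(A) FKG" of Newman's central limit theorem (Newman 1980,
Thm. 2) for the Ising applications of the companion files `IsingMagnetizationCLT`, `IsingLocalObservableCLT`.

The finite-volume FKG inequality is the tree theorem `ising_fkg_holds` (Fortuin–Kasteleyn–Ginibre 1971;
Friedli–Velenik 2017, Thm. 3.21). Here it is passed to the infinite-volume states, in the STRONG form of the tree's
predicate `IsPositivelyAssociated μ` (`μ(A) μ(B) ≤ μ(A ∩ B)` for ALL measurable increasing events `A, B` of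
`{−1,+1}^{ℤ^d}`, not only local ones), by the route of Grimmett 2006, Prop. (4.10)(b) / Thm. (4.17)(b) already
executed for the random-cluster box limits (`InfiniteVolumeFKG.lean`): transport the spin space `{−1,+1}^{ℤ^d}` to
the configuration space `Set ℤ^d` along the order isomorphism `spinConfigEquivSet` (`σ ↦ {x | σ_x = +1}`,
`FreeStateLimit.lean`), where positive association survives local limits
(`isPositivelyAssociated_of_tendsto_isLocalEvent`, Lindqvist 1988 Thm. 5.1 — cylinder events suffice).

* `isPositivelyAssociated_isingMeasure` — Friedli–Velenik Thm. 3.21 as a property of the finite-volume Gibbs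
  distribution `μ^{bc}_{Λ;β,h}` (`β ≥ 0`, any `h`, any boundary condition, any locally finite graph).
* `monotone_spinConfigEquivSet`, `monotone_spinConfigEquivSet_symm` — `σ ↦ {σ = +1}` is an order isomorphism.
* `isPositivelyAssociated_of_tendsto_isingExpect` — **a local limit of finite-volume Ising distributions is
  positively associated**: if `⟨F⟩^{bc_n}_{Λ_n;β,h} → ∫ F dμ` for every local observable `F`, then
  `IsPositivelyAssociated μ`.
* `tendsto_isingExpect_box_of_spinCorr_eq` — a probability measure whose correlations `∫ σ_A dμ` are the box
  limits of `⟨σ_A⟩^{bc}_{Λ_L;β,h}` is the local limit of these boxes (Friedli–Velenik Lemma 3.19: local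
  observables are linear combinations of spin products).
* `isPositivelyAssociated_of_spinCorr_eq_freeCorr` / `…_plusCorr` / `…_minusCorr` — **the free state (`β, h ≥ 0`)
  and the plus and minus states (`β ≥ 0`, every `h`), i.e. the probability measures with correlations
  `freeCorr d β h`, `plusCorr d β h`, `minusCorr d β h` (they exist and are unique: `exists_freeMeasure_holds`,
  `exists_plusMeasure_holds`, `exists_minusMeasure_holds`, `measure_eq_of_forall_spinCorr_eq`), are positively
  associated**; covariance form `integral_mul_integral_le_of_spinCorr_eq_freeCorr`.

## References

* C. M. Fortuin, P. W. Kasteleyn, J. Ginibre, Comm. Math. Phys. 22 (1971) 89–103. [FortuinKasteleynGinibre1971]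
* S. Friedli, Y. Velenik, *Statistical Mechanics of Lattice Systems*, CUP 2017, Thm. 3.21, Thm. 3.17, Lemma 3.19,
  Exercise 3.16, §6.4. [FriedliVelenik2017]
* G. Grimmett, *The Random-Cluster Model*, Springer 2006, Prop. (4.10)(b), (4.4)–(4.9). [Grimmett2006]
* C. M. Newman, Comm. Math. Phys. 74 (1980) 119–128, hypothesis (A) of Thm. 2. [Newman1980]
-/

noncomputable section

namespace Summit.CriticalPhenomena.PercolationContinuityZ3.Theorems.FK

namespace IsingCLT

open MeasureTheory Filter Topology Finset Set
open Literature.Probability.Percolation Literature.Probability.LatticeModels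

/-! ### Finite volume: Friedli–Velenik Thm. 3.21 as positive association of the measure -/

/-- The indicator of an increasing event is an increasing function. [folklore] -/
theorem monotone_indicator_one_of_isUpperSet {Ω : Type*} [Preorder Ω] {A : Set Ω} (hA : IsUpperSet A) :
    Monotone (A.indicator (1 : Ω → ℝ)) := by
  intro ω ω' hle
  by_cases hω : ω ∈ A
  · rw [Set.indicator_of_mem hω, Set.indicator_of_mem (hA hle hω), Pi.one_apply, Pi.one_apply]
  · rw [Set.indicator_of_notMem hω]
    exact Set.indicator_nonneg (fun _ _ => zero_le_one) _

/-- **FKG for the finite-volume Ising model as a property of the measure** (Friedli–Velenik 2017, Thm. 3.21;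
Fortuin–Kasteleyn–Ginibre 1971): for `β ≥ 0`, every field `h`, every boundary condition and every finite `Λ`
in a locally finite graph, `μ^{bc}_{Λ;β,h}` is positively associated — `μ(A) μ(B) ≤ μ(A ∩ B)` for all measurable
increasing events (the tree theorem `ising_fkg_holds` applied to the indicators).
[cite: FriedliVelenik2017, Thm. 3.21] -/
theorem isPositivelyAssociated_isingMeasure {V : Type*} (G : SimpleGraph V) [DecidableEq V] [G.LocallyFinite]
    (Λ : Finset V) {β : ℝ} (hβ : 0 ≤ β) (h : ℝ) (bc : BoundaryCondition V) :
    IsPositivelyAssociated (isingMeasure G Λ β h bc) := by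
  refine isPositivelyAssociated_of_real fun A B hA hB hAm hBm => ?_
  have key := ising_fkg_holds G hβ Λ h bc (A.indicator 1) (B.indicator 1)
    (monotone_indicator_one_of_isUpperSet hA) (monotone_indicator_one_of_isUpperSet hB)
    (measurable_const.indicator hAm) (measurable_const.indicator hBm)
  have hmul : (A.indicator (1 : SpinConfig V → ℝ) * B.indicator 1) = (A ∩ B).indicator 1 := by
    rw [Set.inter_indicator_one]
  simp only [isingExpect, hmul, integral_indicator_one hAm, integral_indicator_one hBm,
    integral_indicator_one (hAm.inter hBm)] at key
  exact key

/-! ### `σ ↦ {x | σ_x = +1}` is an order isomorphism `{−1,+1}^V ≃ (Set V, ⊆)` -/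

/-- `−1 ≤ u` for every `u ∈ ℤˣ` (the order `−1 < 1`; `intUnits_eq_one_of_one_le` is the tree's). [folklore] -/
theorem neg_one_le_units (u : ℤˣ) : (-1 : ℤˣ) ≤ u := by
  rcases Int.units_eq_one_or u with rfl | rfl <;> decide

/-- `u ≤ 1` for every `u ∈ ℤˣ`. [folklore] -/
theorem units_le_one (u : ℤˣ) : u ≤ (1 : ℤˣ) := by
  rcases Int.units_eq_one_or u with rfl | rfl <;> decide

/-- **`spinConfigEquivSet` is monotone**: `σ ≤ τ ⇒ {σ = +1} ⊆ {τ = +1}`. [folklore] -/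
theorem monotone_spinConfigEquivSet {V : Type*} : Monotone (spinConfigEquivSet V) := by
  intro σ τ hle x hx
  rw [mem_spinConfigEquivSet_iff] at hx ⊢
  have h := hle x
  rw [hx] at h
  exact intUnits_eq_one_of_one_le h

/-- `(spinConfigEquivSet V).symm ω x = +1 ↔ x ∈ ω`. [folklore] -/
theorem spinConfigEquivSet_symm_apply_eq_one_iff {V : Type*} (ω : Set V) (x : V) :
    (spinConfigEquivSet V).symm ω x = 1 ↔ x ∈ ω := by
  rw [← mem_spinConfigEquivSet_iff, MeasurableEquiv.apply_symm_apply]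

/-- **The inverse `ω ↦ (x ↦ +1 if x ∈ ω else −1)` is monotone**. [folklore] -/
theorem monotone_spinConfigEquivSet_symm {V : Type*} : Monotone (spinConfigEquivSet V).symm := by
  intro ω ω' hle x
  by_cases hx : x ∈ ω
  · have h1 : (spinConfigEquivSet V).symm ω x = 1 := (spinConfigEquivSet_symm_apply_eq_one_iff ω x).2 hx
    have h2 : (spinConfigEquivSet V).symm ω' x = 1 :=
      (spinConfigEquivSet_symm_apply_eq_one_iff ω' x).2 (hle hx)
    rw [h1, h2]
  · have h1 : (spinConfigEquivSet V).symm ω x ≠ 1 :=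
      fun h => hx ((spinConfigEquivSet_symm_apply_eq_one_iff ω x).1 h)
    rcases Int.units_eq_one_or ((spinConfigEquivSet V).symm ω x) with h | h
    · exact absurd h h1
    · rw [h]; exact neg_one_le_units _

/-! ### Local limits of finite-volume Ising distributions are positively associated -/

variable {d : ℕ}

/-- **Positive association survives the thermodynamic limit** (Grimmett 2006, Prop. (4.10)(b), for the Ising
model; Friedli–Velenik 2017, §6.4): let `β ≥ 0` and let `μ` be a probability measure on `{−1,+1}^{ℤ^d}` such that
`⟨F⟩^{bc_n}_{Λ_n;β,h} → ∫ F dμ` for every observable `F` depending on finitely many spins, along some sequence of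
finite volumes `Λ_n` and boundary conditions `bc_n`. Then `μ` is positively associated: `μ(A)μ(B) ≤ μ(A ∩ B)` for
ALL measurable increasing events `A, B`. Proof: push everything to `Set ℤ^d` along the order isomorphism
`spinConfigEquivSet`; the images of the finite-volume measures are positively associated (monotone images) and
converge on every local event (its indicator pulls back to a local observable,
`dependsOn_indicator_preimage_of_determinedBy`); apply `isPositivelyAssociated_of_tendsto_isLocalEvent` and pull
back along the monotone inverse. [cite: Grimmett2006, Prop. (4.10)(b); FriedliVelenik2017, Thm. 3.21 and §6.4] -/
theorem isPositivelyAssociated_of_tendsto_isingExpect {β h : ℝ} (hβ : 0 ≤ β) (Λ : ℕ → Finset (Site d))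
    (bc : ℕ → BoundaryCondition (Site d)) (μ : Measure (SpinConfig (Site d))) [IsProbabilityMeasure μ]
    (hμ : ∀ (D : Finset (Site d)) (F : SpinConfig (Site d) → ℝ), DependsOn F (↑D : Set (Site d)) →
      Tendsto (fun n : ℕ => isingExpect (zdGraph d) (Λ n) β h (bc n) F) atTop (𝓝 (∫ σ, F σ ∂μ))) :
    IsPositivelyAssociated μ := by
  classical
  set e := spinConfigEquivSet (Site d) with he
  set ν : ℕ → Measure (SpinConfig (Site d)) := fun n => isingMeasure (zdGraph d) (Λ n) β h (bc n) with hν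
  set μs : ℕ → Measure (Set (Site d)) := fun n => (ν n).map e with hμs
  haveI hμ'P : IsProbabilityMeasure (μ.map e) := Measure.isProbabilityMeasure_map e.measurable.aemeasurable
  have hPA : ∀ n, IsPositivelyAssociated (μs n) := fun n =>
    (isPositivelyAssociated_isingMeasure (zdGraph d) (Λ n) hβ h (bc n)).map monotone_spinConfigEquivSet
      e.measurable
  have hconv : ∀ A : Set (Set (Site d)), IsLocalEvent A →
      Tendsto (fun n => μs n A) atTop (𝓝 (μ.map e A)) := by
    intro A hA
    obtain ⟨J, hJ⟩ := hA
    have hAm : MeasurableSet A := measurableSet_of_isLocalEvent_holds ⟨J, hJ⟩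
    set χ : SpinConfig (Site d) → ℝ := (e ⁻¹' A).indicator 1 with hχ
    have hχdep : DependsOn χ (↑J : Set (Site d)) := dependsOn_indicator_preimage_of_determinedBy hJ
    have hval : ∀ n, μs n A = ENNReal.ofReal (isingExpect (zdGraph d) (Λ n) β h (bc n) χ) := by
      intro n
      change ((ν n).map e) A = _
      rw [Measure.map_apply e.measurable hAm, isingExpect, hχ, integral_indicator_one (e.measurable hAm),
        ofReal_measureReal]
    have hlim : μ.map e A = ENNReal.ofReal (∫ σ, χ σ ∂μ) := by
      rw [Measure.map_apply e.measurable hAm, hχ, integral_indicator_one (e.measurable hAm),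
        ofReal_measureReal]
    simp_rw [hval, hlim]
    exact ENNReal.tendsto_ofReal (hμ J χ hχdep)
  have hPA' : IsPositivelyAssociated (μ.map e) :=
    isPositivelyAssociated_of_tendsto_isLocalEvent μs (μ.map e) hPA hconv
  have hback : μ = (μ.map e).map e.symm := by
    rw [Measure.map_map e.symm.measurable e.measurable, MeasurableEquiv.symm_comp_self, Measure.map_id]
  rw [hback]
  exact hPA'.map monotone_spinConfigEquivSet_symm e.symm.measurable

/-! ### States given by their correlations are local limits of the boxes -/

/-- **Local observables follow the correlations** (Friedli–Velenik 2017, Lemma 3.19 and the proof of Thm. 3.17):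
if the box correlations `⟨σ_B⟩^{bc}_{Λ_L;β,h}` converge to `c(B)` for every finite `B`, and `μ` is a probability
measure with `∫ σ_B dμ = c(B)` for all `B`, then `⟨F⟩^{bc}_{Λ_L;β,h} → ∫ F dμ` for every `F` depending on finitely
many spins (write `F = Σ_{B ⊆ D} a_B σ_B`). [cite: FriedliVelenik2017, Lemma 3.19 and Thm. 3.17 (proof)] -/
theorem tendsto_isingExpect_box_of_spinCorr_eq {β h : ℝ} (bc : BoundaryCondition (Site d))
    {c : Finset (Site d) → ℝ}
    (hcorr : ∀ B : Finset (Site d),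
      Tendsto (fun L : ℕ => isingCorr (zdGraph d) (box d L) β h bc B) atTop (𝓝 (c B)))
    (μ : Measure (SpinConfig (Site d))) [IsProbabilityMeasure μ] (hμ : ∀ A : Finset (Site d), spinCorr μ A = c A)
    (D : Finset (Site d)) {F : SpinConfig (Site d) → ℝ} (hF : DependsOn F (↑D : Set (Site d))) :
    Tendsto (fun L : ℕ => isingExpect (zdGraph d) (box d L) β h bc F) atTop (𝓝 (∫ σ, F σ ∂μ)) := by
  classical
  obtain ⟨coef, hc⟩ := exists_sum_spinProduct_of_dependsOn D hF
  have hFeq : F = fun σ => ∑ B : Finset ↥D, coef B *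
      spinProduct (B.map (Function.Embedding.subtype (· ∈ D))) σ := funext hc
  rw [hFeq]
  have hlin : ∀ L : ℕ, isingExpect (zdGraph d) (box d L) β h bc (fun σ => ∑ B : Finset ↥D, coef B *
      spinProduct (B.map (Function.Embedding.subtype (· ∈ D))) σ) =
      ∑ B : Finset ↥D, coef B * isingCorr (zdGraph d) (box d L) β h bc
        (B.map (Function.Embedding.subtype (· ∈ D))) := by
    intro L
    rw [isingExpect_finset_sum' _ _ _ _ β _ _ fun B => (measurable_spinProduct _).const_mul (coef B)]
    refine Finset.sum_congr rfl fun B _ => ?_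
    rw [isingExpect_const_mul' _ _ _ _ β (coef B) (measurable_spinProduct _)]
    rfl
  have hint : ∫ σ, (∑ B : Finset ↥D, coef B * spinProduct (B.map (Function.Embedding.subtype (· ∈ D))) σ) ∂μ =
      ∑ B : Finset ↥D, coef B * c (B.map (Function.Embedding.subtype (· ∈ D))) := by
    rw [integral_finsetSum]
    · refine Finset.sum_congr rfl fun B _ => ?_
      rw [integral_const_mul, ← hμ]
      rfl
    · intro B _
      refine Integrable.const_mul ?_ _
      exact Integrable.of_bound (measurable_spinProduct _).aestronglyMeasurable 1
        (Eventually.of_forall fun σ => by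
          rw [Real.norm_eq_abs]; exact abs_spinProduct_le_one _ σ)
  rw [hint]
  simp_rw [hlin]
  exact tendsto_finsetSum _ fun B _ => (hcorr _).const_mul _

/-! ### The free, plus and minus states are positively associated -/

/-- **THE FREE ISING STATE IS POSITIVELY ASSOCIATED** (Friedli–Velenik 2017, Thm. 3.21 with Exercise 3.16 /
Thm. 3.17; Newman 1980, hypothesis (A) for the Ising model): for `β ≥ 0`, `h ≥ 0`, the probability measure `μ` on
`{−1,+1}^{ℤ^d}` with correlations `∫ σ_A dμ = ⟨σ_A⟩^∅_{β,h} = freeCorr d β h A` (it exists, `exists_freeMeasure_holds`,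
and is unique, `measure_eq_of_forall_spinCorr_eq`) satisfies `μ(A) μ(B) ≤ μ(A ∩ B)` for all measurable increasing
events `A, B` of the infinite configuration. [cite: FriedliVelenik2017, Thm. 3.21 and Exercise 3.16; Newman1980, Thm. 2 (A)] -/
theorem isPositivelyAssociated_of_spinCorr_eq_freeCorr {β h : ℝ} (hβ : 0 ≤ β) (hh : 0 ≤ h)
    (μ : Measure (SpinConfig (Site d))) [IsProbabilityMeasure μ]
    (hμ : ∀ A : Finset (Site d), spinCorr μ A = freeCorr d β h A) : IsPositivelyAssociated μ :=
  isPositivelyAssociated_of_tendsto_isingExpect hβ (fun L => box d L) (fun _ => .free) μ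
    fun D _ hF => tendsto_isingExpect_box_of_spinCorr_eq .free
      (fun B => hasBoxLimit_isingCorr_free_holds (d := d) hβ hh B) μ hμ D hF

/-- **THE PLUS STATE IS POSITIVELY ASSOCIATED** (Friedli–Velenik 2017, Thm. 3.21 with Thm. 3.17; every field `h`,
`β ≥ 0`): the probability measure with correlations `plusCorr d β h` (`exists_plusMeasure_holds`) is positively
associated. [cite: FriedliVelenik2017, Thm. 3.21 and Thm. 3.17] -/
theorem isPositivelyAssociated_of_spinCorr_eq_plusCorr {β : ℝ} (hβ : 0 ≤ β) (h : ℝ)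
    (μ : Measure (SpinConfig (Site d))) [IsProbabilityMeasure μ]
    (hμ : ∀ A : Finset (Site d), spinCorr μ A = plusCorr d β h A) : IsPositivelyAssociated μ :=
  isPositivelyAssociated_of_tendsto_isingExpect hβ (fun L => box d L) (fun _ => .plus) μ
    fun D _ hF => tendsto_isingExpect_box_of_spinCorr_eq .plus
      (fun B => tendsto_isingCorr_plus_box hβ h B) μ hμ D hF

/-- **THE MINUS STATE IS POSITIVELY ASSOCIATED** (Friedli–Velenik 2017, Thm. 3.21 with Thm. 3.17; every field `h`,
`β ≥ 0`): the probability measure with correlations `minusCorr d β h` (`exists_minusMeasure_holds`) is positively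
associated. [cite: FriedliVelenik2017, Thm. 3.21 and Thm. 3.17] -/
theorem isPositivelyAssociated_of_spinCorr_eq_minusCorr {β : ℝ} (hβ : 0 ≤ β) (h : ℝ)
    (μ : Measure (SpinConfig (Site d))) [IsProbabilityMeasure μ]
    (hμ : ∀ A : Finset (Site d), spinCorr μ A = minusCorr d β h A) : IsPositivelyAssociated μ :=
  isPositivelyAssociated_of_tendsto_isingExpect hβ (fun L => box d L) (fun _ => .minus) μ
    fun D _ hF => tendsto_isingExpect_box_of_spinCorr_eq .minus
      (fun B => tendsto_isingCorr_minus_box hβ h B) μ hμ D hF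

/-- **FKG inequality in the free state, covariance form** (Friedli–Velenik 2017, Thm. 3.21 in infinite volume):
for `β, h ≥ 0` and bounded measurable increasing `f, g` on `{−1,+1}^{ℤ^d}`,
`(∫ f dμ)(∫ g dμ) ≤ ∫ f g dμ` under the free state `μ`. [cite: FriedliVelenik2017, Thm. 3.21 and Exercise 3.16] -/
theorem integral_mul_integral_le_of_spinCorr_eq_freeCorr {β h : ℝ} (hβ : 0 ≤ β) (hh : 0 ≤ h)
    (μ : Measure (SpinConfig (Site d))) [IsProbabilityMeasure μ]
    (hμ : ∀ A : Finset (Site d), spinCorr μ A = freeCorr d β h A) {f g : SpinConfig (Site d) → ℝ}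
    (hf : Monotone f) (hg : Monotone g) (hfm : Measurable f) (hgm : Measurable g)
    (hfb : ∃ C, ∀ σ, |f σ| ≤ C) (hgb : ∃ C, ∀ σ, |g σ| ≤ C) :
    (∫ σ, f σ ∂μ) * (∫ σ, g σ ∂μ) ≤ ∫ σ, f σ * g σ ∂μ :=
  (isPositivelyAssociated_of_spinCorr_eq_freeCorr hβ hh μ hμ).integral_mul_integral_le_integral_mul
    hf hg hfm hgm hfb hgb

end IsingCLT

end Summit.CriticalPhenomena.PercolationContinuityZ3.Theorems.FK

end
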